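import Literature.NumberTheory.PAdicHodge.AinfWeierstrassSupersingularTorsion
import Literature.NumberTheory.PAdicHodge.BdRPlusFormalLogTheta
import Literature.NumberTheory.EllipticCurves.FormalGroupChartLimitLogEquivarianceProofs
import Literature.NumberTheory.EllipticCurves.SecondKindColmezFunctionalHodgeLine
import HarnessLib

/-!
# Small points of a supersingular formal group over `𝒪_{ℂ_F}`: no nonzero torsion and no nonzero zero of `log_W` in the ball `‖u‖^{p²−1} < ‖p‖`

Topic `Literature/NumberTheory/PAdicHodge`; namespace `Literature.NumberTheory.PAdicHodge.AinfTop`. THEOREMS ONLY (no definition, no named fact, no instance,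
no `sorry`). Setting: `F` a `p`-adic field, `W/ℤ` an integral Weierstrass equation with SUPERSINGULAR reduction (`p` odd, `A_p(W mod p) = 0`:
`(W.map (ℤ → 𝔽_p)).hasseCoeff p = 0`), `[p] = [p]_W` on `Ŵ(𝔪_{ℂ_F})` (`AinfTop.mulPC`), `log_W(u) := Σ' [Xʲ]log_W·uʲ` (`(W.map (ℤ → ℂ_F)).formalLog`).

* §1 ★ `norm_p_le_norm_pow_of_mulPC_eq_zero` — **`‖p‖ ≤ ‖u‖^{p²−1}` for every nonzero `p`-torsion point** (`[p] = p·R + X^{p²}·S`, `‖R(u)‖ = ‖u‖`; the sharp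
  single-slope bound, of which the tree's `norm_p_lt_norm_pow_of_mulPC_eq_zero` (`‖p‖ < ‖u‖ᵖ`) is a weakening); ★ `eq_zero_of_iterate_mulPC_eq_zero_of_norm_pow_lt`
  — **a `p`-power torsion point with `‖u‖^{p²−1} < ‖p‖` is `0`** (`[p]` is `1`-Lipschitz, so the ball is `[p]`-stable).
* §2 `norm_mulPC_lt_norm_p_of_norm_le` (`‖u‖ ≤ ‖p‖ ⇒ ‖[p]u‖ < ‖p‖`), `exists_norm_iterate_mulPC_lt` (every point has a `[p]`-power multiple of norm `< ‖p‖`),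
  `tsum_formalLog_iterate_mulPC` (`log_W([p]ʳu) = pʳ·log_W(u)`), ★★ `eq_zero_of_tsum_formalLog_eq_zero_of_norm_pow_lt` — **`log_W(u) = 0` and
  `‖u‖^{p²−1} < ‖p‖` imply `u = 0`** (push `u` into the level `‖z‖ < ‖p‖` by `[p]ʳ`, where `log_W` is the injective limit logarithm
  `FormalGroupChart.eq_zero_of_limitLog_eq_zero`, then §1).

Purpose (crux K★ `stmt-BirchSwinnertonDyer-22226`, line `kato_lever`, memo `Lines/kato-lever-K2-ramified-cm-transport.md` §10.1, T5b nondegeneracy): the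
CM-fibre transport `Tτ` of a torsion tower of a K★ cell has `‖(Tτ)₀‖ ≤ ‖ϖ‖` with `‖ϖ‖^{p²−1} = ‖p‖^{(p²−1)/e} < ‖p‖` (`e ≤ 6 < p² − 1`), so
`θ(f P⁰τ) = p^e·log_{E₀}((Tτ)₀)` vanishes ONLY IF `(Tτ)₀ = 0`: either some transported base point is nonzero (then `Pη := f∘P⁰ ∉ Fil¹`, `hnot`) or `T` maps
`T_pŴ_D` into `T_pÊ₀`. Infrastructure only; BSD / K★ are not proved by any of this.

## References
* J. Tate, *p-divisible groups* (1967), §4. [Tate1967]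
* J. H. Silverman, *The Arithmetic of Elliptic Curves* (2009), IV.3.2, IV.4.4, Thm. IV.6.4, IV.7, Prop. VII.2.2. [SilvermanAEC2009]
-/

noncomputable section

open PowerSeries Filter
open scoped Topology Classical

namespace Literature.NumberTheory.PAdicHodge

open Literature Literature.NumberTheory.GaloisRepresentations Literature.NumberTheory.EllipticCurves WeierstrassCurve
open Literature.NumberTheory.GaloisRepresentations.IsNonarchimedeanLocalField Literature.NumberTheory.GaloisRepresentations.LubinTate
open Literature.NumberTheory.EllipticCurves.FormalGroupChart

namespace AinfTop

variable {F : Type} [Field F] [ValuativeRel F] [TopologicalSpace F] [IsNonarchimedeanLocalField F] [CharZero F]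
  {p : ℕ} [Fact p.Prime] (W : WeierstrassCurve ℤ)

/-! ## §1 Torsion: the sharp bound `‖p‖ ≤ ‖u‖^{p²−1}` and the torsion-free ball -/

omit [CharZero F] in
/-- ★ **`‖p‖ ≤ ‖u‖^{p²−1}` for every nonzero `p`-torsion point `u ∈ Ŵ(𝔪_{ℂ_F})` at supersingular reduction** (`p` odd, `A_p(W mod p) = 0`): from
`[p] = p·R + X^{p²}·S` (`R = X + …`, tree `exists_formalMul_prime_eq_of_hasseCoeff_eq_zero`) and `[p](u) = 0`, `‖p‖·‖u‖ = ‖u‖^{p²}·‖S(u)‖ ≤ ‖u‖^{p²}`.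
[cite: Tate1967, §4] [cite: SilvermanAEC2009, IV.7] -/
theorem norm_p_le_norm_pow_of_mulPC_eq_zero (hp2 : p ≠ 2) (hA : (W.map (Int.castRingHom (ZMod p))).hasseCoeff p = 0)
    (u : (maxNilIdealC F).toIdeal) (hu0 : ((u : CBall F) : CompletedAlgClosure F) ≠ 0)
    (hu : ((mulPC F p W u : (maxNilIdealC F).toIdeal) : CBall F) = 0) :
    ‖(p : CompletedAlgClosure F)‖ ≤ ‖((u : CBall F) : CompletedAlgClosure F)‖ ^ (p ^ 2 - 1) := by
  have hp : p.Prime := Fact.out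
  obtain ⟨R, S, hRS, hR0, hR1, -⟩ := exists_formalMul_prime_eq_of_hasseCoeff_eq_zero W hp2 hA
  set x : CompletedAlgClosure F := ((u : CBall F) : CompletedAlgClosure F) with hx
  have hx1 : ‖x‖ < 1 := u.2
  have hxpos : 0 < ‖x‖ := norm_pos_iff.2 hu0
  -- `R = X·(1 + X·R₁)`, so `‖R(u)‖ = ‖u‖`
  obtain ⟨R', hR'⟩ := PowerSeries.X_dvd_iff.mpr hR0
  have hR'0 : constantCoeff R' = 1 := by
    have h := congrArg (coeff 1) hR'
    rw [hR1, PowerSeries.coeff_succ_X_mul, coeff_zero_eq_constantCoeff] at h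
    exact h.symm
  obtain ⟨R₁, hR₁⟩ := PowerSeries.X_dvd_iff.mpr (show constantCoeff (R' - 1) = 0 by rw [map_sub, hR'0, map_one, sub_self])
  have hRu : (evalAt (maxNilIdealC F) u R : CompletedAlgClosure F) =
      x * (1 + (evalAt (maxNilIdealC F) u (X * R₁) : CompletedAlgClosure F)) := by
    have hR'' : R = X * (1 + X * R₁) := by rw [← hR₁, add_sub_cancel, hR']
    rw [hR'', map_mul, map_add, map_one, evalAt_maxNilIdealC_X, Subring.coe_mul, Subring.coe_add, Subring.coe_one]
  have hsmall : ‖((evalAt (maxNilIdealC F) u (X * R₁) : CBall F) : CompletedAlgClosure F)‖ < 1 :=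
    lt_of_le_of_lt (NumberTheory.EllipticCurves.norm_evalAt_le_of_constantCoeff u
      (by rw [map_mul, constantCoeff_X, zero_mul])) hx1
  have hone : ‖(1 : CompletedAlgClosure F) + (evalAt (maxNilIdealC F) u (X * R₁) : CompletedAlgClosure F)‖ = 1 := by
    rw [IsUltrametricDist.norm_add_eq_max_of_norm_ne_norm (by rw [norm_one]; exact (ne_of_lt hsmall).symm), norm_one,
      max_eq_left hsmall.le]
  have hnormR : ‖(evalAt (maxNilIdealC F) u R : CompletedAlgClosure F)‖ = ‖x‖ := by
    rw [hRu, norm_mul, hone, mul_one]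
  -- `[p](u) = 0`: `p·R(u) = −u^{p²}·S(u)`, so `‖p‖‖u‖ ≤ ‖u‖^{p²}`
  have heval := coe_mulPC_eq_of_decomp W hRS u
  rw [hu] at heval
  have hS1 : ‖((evalAt (maxNilIdealC F) u S : CBall F) : CompletedAlgClosure F)‖ ≤ 1 :=
    NumberTheory.EllipticCurves.norm_coe_unitBall_le_one _
  have hkey : ‖(p : CompletedAlgClosure F)‖ * ‖x‖ ≤ ‖x‖ ^ (p ^ 2) := by
    have h1 : ((p : CBall F) : CompletedAlgClosure F) * (evalAt (maxNilIdealC F) u R : CompletedAlgClosure F) =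
        -(x ^ (p ^ 2) * (evalAt (maxNilIdealC F) u S : CompletedAlgClosure F)) := by
      have h := congrArg (fun z : CBall F => (z : CompletedAlgClosure F)) heval
      simp only [Subring.coe_add, Subring.coe_mul, SubmonoidClass.coe_pow, Subring.coe_zero] at h
      exact eq_neg_of_add_eq_zero_left h.symm
    have h2 := congrArg (fun z => ‖z‖) h1
    simp only [norm_mul, norm_neg, norm_pow, hnormR, Subring.coe_natCast] at h2
    rw [h2]
    exact mul_le_of_le_one_right (pow_nonneg (norm_nonneg _) _) hS1
  -- divide by `‖x‖ > 0`
  have hq : p ^ 2 = (p ^ 2 - 1) + 1 := (Nat.sub_add_cancel (Nat.one_le_pow _ _ hp.pos)).symm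
  rw [hq, pow_succ] at hkey
  exact le_of_mul_le_mul_right hkey hxpos

omit [CharZero F] [Fact p.Prime] in
/-- `[p]` does not increase norms on `Ŵ(𝔪_{ℂ_F})` (`[p](0) = 0`, integral coefficients). [cite: SilvermanAEC2009, IV.3.2] -/
theorem norm_mulPC_le (u : (maxNilIdealC F).toIdeal) :
    ‖(((mulPC F p W u : (maxNilIdealC F).toIdeal) : CBall F) : CompletedAlgClosure F)‖ ≤ ‖((u : CBall F) : CompletedAlgClosure F)‖ := by
  rw [mulPC, coe_evalPt₁_eq_evalAt]
  exact NumberTheory.EllipticCurves.norm_evalAt_le_of_constantCoeff (K := CompletedAlgClosure F) u (W.constantCoeff_formalMul p)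

omit [CharZero F] [Fact p.Prime] in
/-- Iterates: `‖[p]ʳ u‖ ≤ ‖u‖`. [cite: SilvermanAEC2009, IV.3.2] -/
theorem norm_iterate_mulPC_le (u : (maxNilIdealC F).toIdeal) (r : ℕ) :
    ‖((((mulPC F p W)^[r] u : (maxNilIdealC F).toIdeal) : CBall F) : CompletedAlgClosure F)‖ ≤ ‖((u : CBall F) : CompletedAlgClosure F)‖ := by
  induction r with
  | zero => exact le_rfl
  | succ r ih => rw [Function.iterate_succ_apply']; exact (norm_mulPC_le W _).trans ih

omit [CharZero F] in
/-- ★ **The torsion-free ball**: at supersingular reduction (`p` odd), a point `u ∈ Ŵ(𝔪_{ℂ_F})` with `[p]ᵏ u = 0` for some `k` and `‖u‖^{p²−1} < ‖p‖` is `0`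
(by induction on `k`: `[p]u` lies in the same ball, so `[p]u = 0`, and then `u = 0` by the sharp bound). [cite: Tate1967, §4] [cite: SilvermanAEC2009, IV.7] -/
theorem eq_zero_of_iterate_mulPC_eq_zero_of_norm_pow_lt (hp2 : p ≠ 2) (hA : (W.map (Int.castRingHom (ZMod p))).hasseCoeff p = 0) {k : ℕ}
    {u : (maxNilIdealC F).toIdeal} (hk : ((((mulPC F p W)^[k] u : (maxNilIdealC F).toIdeal) : CBall F) : CompletedAlgClosure F) = 0)
    (hsmall : ‖((u : CBall F) : CompletedAlgClosure F)‖ ^ (p ^ 2 - 1) < ‖(p : CompletedAlgClosure F)‖) :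
    ((u : CBall F) : CompletedAlgClosure F) = 0 := by
  induction k generalizing u with
  | zero => simpa using hk
  | succ k ih =>
    rw [Function.iterate_succ_apply] at hk
    have hsmall' : ‖(((mulPC F p W u : (maxNilIdealC F).toIdeal) : CBall F) : CompletedAlgClosure F)‖ ^ (p ^ 2 - 1) <
        ‖(p : CompletedAlgClosure F)‖ :=
      (pow_le_pow_left₀ (norm_nonneg _) (norm_mulPC_le W u) _).trans_lt hsmall
    have hpu : (((mulPC F p W u : (maxNilIdealC F).toIdeal) : CBall F) : CompletedAlgClosure F) = 0 := ih hk hsmall'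
    by_contra hu0
    have h := norm_p_le_norm_pow_of_mulPC_eq_zero W hp2 hA u hu0 (Subtype.ext hpu)
    exact absurd (h.trans_lt hsmall) (lt_irrefl _)

/-! ## §2 Zeros of `log_W`: push into the level `‖z‖ < ‖p‖` -/

/-- **`‖u‖ ≤ ‖p‖ ⇒ ‖[p]u‖ < ‖p‖`** (`‖[p]u‖ ≤ max(‖p‖‖u‖, ‖u‖ᵖ)`, contraction of `[p]`). [cite: SilvermanAEC2009, IV.4.4] -/
theorem norm_mulPC_lt_norm_p_of_norm_le [Fact (¬ IsUnit (p : integerC F))] (u : (maxNilIdealC F).toIdeal)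
    (hu : ‖((u : CBall F) : CompletedAlgClosure F)‖ ≤ ‖(p : CompletedAlgClosure F)‖) :
    ‖(((mulPC F p W u : (maxNilIdealC F).toIdeal) : CBall F) : CompletedAlgClosure F)‖ < ‖(p : CompletedAlgClosure F)‖ := by
  have hp1 : ‖(p : CompletedAlgClosure F)‖ < 1 := norm_natCast_C_lt_one'
  have hp0 : 0 < ‖(p : CompletedAlgClosure F)‖ := norm_pos_iff.2 (natCast_C_ne_zero (Fact.out : p.Prime).ne_zero)
  -- `[p](0) = 0` (norm `≤ ‖0‖ = 0`)
  have h0 : (((mulPC F p W (0 : (maxNilIdealC F).toIdeal) : (maxNilIdealC F).toIdeal) : CBall F) : CompletedAlgClosure F) = 0 := by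
    have h := norm_mulPC_le (F := F) (p := p) W (0 : (maxNilIdealC F).toIdeal)
    rw [ZeroMemClass.coe_zero, ZeroMemClass.coe_zero, norm_zero] at h
    exact norm_le_zero_iff.1 h
  have h : ‖(((mulPC F p W u : (maxNilIdealC F).toIdeal) : CBall F) : CompletedAlgClosure F) -
      (((mulPC F p W (0 : (maxNilIdealC F).toIdeal) : (maxNilIdealC F).toIdeal) : CBall F) : CompletedAlgClosure F)‖ ≤
      max (‖(p : CompletedAlgClosure F)‖ * ‖((u : CBall F) : CompletedAlgClosure F) - (((0 : (maxNilIdealC F).toIdeal) : CBall F) : CompletedAlgClosure F)‖)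
        (‖((u : CBall F) : CompletedAlgClosure F) - (((0 : (maxNilIdealC F).toIdeal) : CBall F) : CompletedAlgClosure F)‖ ^ p) :=
    norm_formalMul_sub_le_max (K := CompletedAlgClosure F) (p := p) W u (0 : (maxNilIdealC F).toIdeal)
  rw [h0, sub_zero, ZeroMemClass.coe_zero, ZeroMemClass.coe_zero, sub_zero] at h
  refine h.trans_lt (max_lt ?_ ?_)
  · calc ‖(p : CompletedAlgClosure F)‖ * ‖((u : CBall F) : CompletedAlgClosure F)‖ ≤ ‖(p : CompletedAlgClosure F)‖ * ‖(p : CompletedAlgClosure F)‖ :=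
          mul_le_mul_of_nonneg_left hu (norm_nonneg _)
      _ < ‖(p : CompletedAlgClosure F)‖ * 1 := mul_lt_mul_of_pos_left hp1 hp0
      _ = ‖(p : CompletedAlgClosure F)‖ := mul_one _
  · calc ‖((u : CBall F) : CompletedAlgClosure F)‖ ^ p ≤ ‖(p : CompletedAlgClosure F)‖ ^ p := pow_le_pow_left₀ (norm_nonneg _) hu p
      _ < ‖(p : CompletedAlgClosure F)‖ ^ 1 := pow_lt_pow_right_of_lt_one₀ hp0 hp1 (Fact.out : p.Prime).one_lt
      _ = ‖(p : CompletedAlgClosure F)‖ := pow_one _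

/-- **Every point of `Ŵ(𝔪_{ℂ_F})` has a `[p]`-power multiple of norm `< ‖p‖`.** [cite: SilvermanAEC2009, Prop. IV.3.2 with Prop. VII.2.2] -/
theorem exists_norm_iterate_mulPC_lt [Fact (¬ IsUnit (p : integerC F))] [IsAdicComplete (Ideal.span {(p : integerC F)}) (integerC F)]
    [(curveOver (CompletedAlgClosure F) W).IsElliptic] (u : (maxNilIdealC F).toIdeal) :
    ∃ r : ℕ, ‖((((mulPC F p W)^[r] u : (maxNilIdealC F).toIdeal) : CBall F) : CompletedAlgClosure F)‖ < ‖(p : CompletedAlgClosure F)‖ := by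
  obtain ⟨r, hr⟩ := GaloisContinuity.exists_norm_iterate_mulPC_le (F := F) (p := p) W u
  refine ⟨r + 1, ?_⟩
  rw [Function.iterate_succ_apply']
  exact norm_mulPC_lt_norm_p_of_norm_le W _ hr

omit [CharZero F] in
/-- **`log_W([p]ʳ u) = pʳ·log_W(u)`** for the series values on `Ŵ(𝔪_{ℂ_F})`. [cite: SilvermanAEC2009, Thm. IV.6.4] -/
theorem tsum_formalLog_iterate_mulPC [Fact (¬ IsUnit (p : integerC F))] [CharZero (CompletedAlgClosure F)] (u : (maxNilIdealC F).toIdeal) (r : ℕ) :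
    ∑' j : ℕ, PowerSeries.coeff j (W.map (Int.castRingHom (CompletedAlgClosure F))).formalLog *
        ((((mulPC F p W)^[r] u : (maxNilIdealC F).toIdeal) : CBall F) : CompletedAlgClosure F) ^ j =
      (p : CompletedAlgClosure F) ^ r *
        ∑' j : ℕ, PowerSeries.coeff j (W.map (Int.castRingHom (CompletedAlgClosure F))).formalLog * ((u : CBall F) : CompletedAlgClosure F) ^ j := by
  have hpC : ‖(p : CompletedAlgClosure F)‖ < 1 := norm_natCast_C_lt_one'
  obtain ⟨k, hk⟩ := exists_nat_norm_coeff_formalLog_map_le_pow (K := CompletedAlgClosure F) W hpC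
  have h := norm_tsum_iterate_formalMul_sub_pow_mul_le (K := CompletedAlgClosure F) W _
    (W.map (Int.castRingHom (CompletedAlgClosure F))).constantCoeff_formalLog k hk le_rfl (norm_coeff_formalLog_map_cocycle_le W)
    (Fact.out : p.Prime).one_le u r
  rw [norm_le_zero_iff, sub_eq_zero] at h
  exact h

set_option maxHeartbeats 800000 in
/-- ★★ **A nonzero zero of `log_W` cannot be small**: at supersingular reduction (`p` odd), if `u ∈ Ŵ(𝔪_{ℂ_F})` satisfies
`Σ' [Xʲ]log_W·uʲ = 0` and `‖u‖^{p²−1} < ‖p‖` then `u = 0`. Proof: push `u` into the level `‖z‖ < ‖p‖` by `[p]ʳ` (the value stays `0`), where the series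
is the limit logarithm of the point `P(z)` of `E₁(ℂ_F)` (`tsum_coeff_formalLog_zCoord_eq_limitLog`) which has no kernel there
(`eq_zero_of_limitLog_eq_zero`); so `[p]ʳu = 0` and §1 applies. [cite: SilvermanAEC2009, Thm. IV.6.4] [cite: Tate1967, §4] -/
theorem eq_zero_of_tsum_formalLog_eq_zero_of_norm_pow_lt [Fact (¬ IsUnit (p : integerC F))]
    [IsAdicComplete (Ideal.span {(p : integerC F)}) (integerC F)] [CharZero (CompletedAlgClosure F)]
    [(curveOver (CompletedAlgClosure F) W).IsElliptic] (hp2 : p ≠ 2) (hA : (W.map (Int.castRingHom (ZMod p))).hasseCoeff p = 0)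
    {u : (maxNilIdealC F).toIdeal}
    (hlog : ∑' j : ℕ, PowerSeries.coeff j (W.map (Int.castRingHom (CompletedAlgClosure F))).formalLog * ((u : CBall F) : CompletedAlgClosure F) ^ j = 0)
    (hsmall : ‖((u : CBall F) : CompletedAlgClosure F)‖ ^ (p ^ 2 - 1) < ‖(p : CompletedAlgClosure F)‖) :
    ((u : CBall F) : CompletedAlgClosure F) = 0 := by
  have hpC : ‖(p : CompletedAlgClosure F)‖ < 1 := norm_natCast_C_lt_one'
  have hp0 : (p : CompletedAlgClosure F) ≠ 0 := natCast_C_ne_zero (Fact.out : p.Prime).ne_zero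
  have hp1v : NormedField.valuation (p : CompletedAlgClosure F) < 1 := by
    rw [← NNReal.coe_lt_coe, NormedField.valuation_apply, coe_nnnorm]; exact hpC
  obtain ⟨r, hr⟩ := exists_norm_iterate_mulPC_lt (p := p) W u
  set t : (maxNilIdealC F).toIdeal := (mulPC F p W)^[r] u with ht
  -- the value at `t = [p]ʳ u` is `pʳ · 0 = 0`
  have hlogt : ∑' j : ℕ, PowerSeries.coeff j (W.map (Int.castRingHom (CompletedAlgClosure F))).formalLog *
      ((t : CBall F) : CompletedAlgClosure F) ^ j = 0 := by
    rw [ht, tsum_formalLog_iterate_mulPC W u r, hlog, mul_zero]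
  -- the point `Q = P(t)` lies in the level with `‖z(Q)‖ < ‖p‖`
  have hzQ : (ptOfZ (CompletedAlgClosure F) W t).zCoord = ((t : CBall F) : CompletedAlgClosure F) := zCoord_ptOfZ t
  have hQlev : ptOfZ (CompletedAlgClosure F) W t ∈
      level (NormedField.valuation (K := CompletedAlgClosure F)) (curveOver (CompletedAlgClosure F) W)
        (NormedField.valuation (p : CompletedAlgClosure F)) := by
    refine ⟨NumberTheory.EllipticCurves.ptOfZ_mem_kernel (K := CompletedAlgClosure F) (W := W) t, ?_⟩
    rw [hzQ, ← NNReal.coe_le_coe, NormedField.valuation_apply, NormedField.valuation_apply, coe_nnnorm, coe_nnnorm]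
    exact hr.le
  have hlt : NormedField.valuation (ptOfZ (CompletedAlgClosure F) W t).zCoord < NormedField.valuation (p : CompletedAlgClosure F) := by
    rw [hzQ, ← NNReal.coe_lt_coe, NormedField.valuation_apply, NormedField.valuation_apply, coe_nnnorm, coe_nnnorm]; exact hr
  -- the series value is the limit logarithm there
  have hcurve : (curveOver (CompletedAlgClosure F) W).formalLog = (W.map (Int.castRingHom (CompletedAlgClosure F))).formalLog := by
    rw [curveOver_eq_map_map_rat, WeierstrassCurve.map_map]
    congr 2
    exact RingHom.ext_int _ _
  have hlim : limitLog (NormedField.valuation (K := CompletedAlgClosure F)) (curveOver (CompletedAlgClosure F) W) p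
      (ptOfZ (CompletedAlgClosure F) W t) = 0 := by
    rw [← tsum_coeff_formalLog_zCoord_eq_limitLog W hpC hQlev, hzQ, hcurve]
    exact hlogt
  have hQ0 : ptOfZ (CompletedAlgClosure F) W t = 0 :=
    eq_zero_of_limitLog_eq_zero hp0 hp1v (limitLog_spec_of_completeSpace hp0 hp1v) hQlev hlt hlim
  have ht0 : ((t : CBall F) : CompletedAlgClosure F) = 0 := by
    rw [← hzQ, hQ0, WeierstrassCurve.Affine.Point.zCoord_zero]
  exact eq_zero_of_iterate_mulPC_eq_zero_of_norm_pow_lt W hp2 hA (k := r) ht0 hsmall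

end AinfTop

end Literature.NumberTheory.PAdicHodge
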